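import Mathlib.Analysis.SpecialFunctions.Integrals.Basic
import Mathlib.NumberTheory.ArithmeticFunction.VonMangoldt
import Mathlib.Data.Nat.Squarefree
import Mathlib.Analysis.SpecialFunctions.Complex.Log

/-!
# `SignCone.ConeMagnification`, line `Sketch` (r3): the torus inequality for EVENTUALLY-`Λ` weights, II —
# Bohr means of `(1/2 − Re P(1/2+it)) · |Σ_{A⊆S} e^{i|A|φ} n_A^{it}|² ≥ 0`
(crux stmt-RiemannHypothesis-16303; HELPER file, `--supports`)

Part I (`…TorusFiniteBoundary.lean`) turns the Carathéodory majorant of an eventually-`Λ` weight `c` into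
`Re P(1/2 + it) ≤ 1/2` for all real `t`, `P` the Dirichlet polynomial of `c − Λ`.  Here: for ANY real sequence `a`
supported on `{1, …, N−1}` with `Σ_{n} a(n) n^{-1/2} cos(t log n) ≤ 1/2` for all `t`, and any finite set `S` of
primes and phase `φ`, the torus inequality `Σ_{D⊆S} a(n_D) n_D^{-1/2} 2^{-|D|} cos(|D|φ) ≤ 1/2` holds
(`torusSum_le_half_of_re_le_half`).  Proof = the MODEL argument of the stub's docstring made honest in the one case
where it is honest (a Dirichlet POLYNOMIAL, continuous on the line): multiply the nonnegative function
`1/2 − Re P(1/2+it)` by the nonnegative resonator `|Q(t)|²`, `Q(t) = Σ_{A⊆S} e^{i|A|φ} n_A^{it}`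
(`= 2^{|S|} Π_{p∈S}(1 + cos(t log p + φ))`), expand into a finite trigonometric sum
(`trigExpansion`), and take the Bohr mean: a finite trigonometric sum with nonnegative real part has nonnegative
zero-frequency part (`re_sum_filter_nonneg_of_trigSum_re_nonneg`, by `(1/T)∫₀ᵀ`); the zero frequencies are
`log n_A = log n + log n_B`, i.e. `B ⊆ A`, `n = n_{A∖B}` (`log_prod_eq_iff`, unique factorisation), and summing
them (`sum_powerset_pairs`) gives `2^{|S|}(1/2 − torus sum)`.
-/

noncomputable section

-- `Summit.RiemannHypothesis.RiemannHypothesis.…` repeats a namespace component by design (D-0017 layout).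
set_option linter.dupNamespace false

open scoped BigOperators ComplexConjugate
open Complex Filter Set MeasureTheory intervalIntegral

namespace Summit.RiemannHypothesis.RiemannHypothesis.Theorems.SignConeConeMagnification

/-! ## Bohr means of finite trigonometric sums -/

/-- **Zero-frequency extraction.**  If a finite trigonometric sum `G(t) = Σ_j β_j e^{iλ_j t}` has `Re G(t) ≥ 0`
for all real `t`, then `Re Σ_{λ_j = 0} β_j ≥ 0`: `0 ≤ ∫₀ᵀ Re G = T · Re Σ_{λ_j=0} β_j + Re Σ_{λ_j≠0} β_j (e^{iλ_jT}−1)/(iλ_j)`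
and the last sum is bounded by `Σ 2‖β_j‖/|λ_j|` uniformly in `T`. [folklore] -/
theorem re_sum_filter_nonneg_of_trigSum_re_nonneg {ι : Type*} (J : Finset ι) (β : ι → ℂ) (lam : ι → ℝ)
    (h : ∀ t : ℝ, 0 ≤ (∑ j ∈ J, β j * cexp (I * (lam j * t))).re) :
    0 ≤ (∑ j ∈ J.filter (fun j => lam j = 0), β j).re := by
  classical
  set Z : ℝ := (∑ j ∈ J.filter (fun j => lam j = 0), β j).re with hZ
  set C : ℝ := ∑ j ∈ J, 2 * ‖β j‖ / |lam j| with hC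
  have hC0 : 0 ≤ C := Finset.sum_nonneg fun j _ => by positivity
  -- the integral identity and bound: `0 ≤ T * Z + C` for every `T > 0`
  have key : ∀ T : ℝ, 0 < T → 0 ≤ T * Z + C := by
    intro T hT
    have hint : ∀ j ∈ J, IntervalIntegrable (fun t : ℝ => β j * cexp (I * (lam j * t))) volume 0 T :=
      fun j _ => (Continuous.intervalIntegrable (by fun_prop) _ _)
    -- termwise integrals
    have hterm : ∀ j ∈ J, ∫ t in (0 : ℝ)..T, β j * cexp (I * (lam j * t)) =
        if lam j = 0 then (T : ℂ) * β j
        else β j * ((cexp (I * lam j * T) - 1) / (I * lam j)) := by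
      intro j _
      split_ifs with hj
      · have hj' : (lam j : ℂ) = 0 := by exact_mod_cast hj
        have hfun : (fun t : ℝ => β j * cexp (I * (lam j * t))) = fun _ => β j := by
          funext t
          rw [hj', zero_mul, mul_zero, Complex.exp_zero, mul_one]
        rw [hfun, intervalIntegral.integral_const, sub_zero, Complex.real_smul]
      · have hc : (I * lam j : ℂ) ≠ 0 := mul_ne_zero I_ne_zero (by exact_mod_cast hj)
        have := integral_exp_mul_complex (a := 0) (b := T) hc
        simp only [Complex.ofReal_zero, mul_zero, Complex.exp_zero] at this
        rw [intervalIntegral.integral_const_mul]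
        simp_rw [show ∀ t : ℝ, I * ((lam j : ℂ) * t) = I * lam j * t from fun t => by ring]
        rw [this]
    have hI : ∫ t in (0 : ℝ)..T, (∑ j ∈ J, β j * cexp (I * (lam j * t))).re =
        (∑ j ∈ J, ∫ t in (0 : ℝ)..T, β j * cexp (I * (lam j * t))).re := by
      rw [← intervalIntegral.integral_finsetSum hint]
      have hcont : Continuous fun t : ℝ => ∑ j ∈ J, β j * cexp (I * (lam j * t)) := by fun_prop
      exact intervalIntegral.intervalIntegral_re (hcont.intervalIntegrable _ _)
    have hnonneg : 0 ≤ ∫ t in (0 : ℝ)..T, (∑ j ∈ J, β j * cexp (I * (lam j * t))).re :=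
      intervalIntegral.integral_nonneg hT.le fun t _ => h t
    rw [hI, Finset.sum_congr rfl hterm, Complex.re_sum] at hnonneg
    -- compare termwise with `T * (zero-frequency part) + C`
    have hsplit : ∑ j ∈ J, (if lam j = 0 then (T : ℂ) * β j
        else β j * ((cexp (I * lam j * T) - 1) / (I * lam j))).re ≤ T * Z + C := by
      rw [hZ, hC, ← Finset.sum_filter_add_sum_filter_not J (fun j => lam j = 0), Complex.re_sum,
        Finset.mul_sum]
      have h1 : ∑ j ∈ J.filter (fun j => lam j = 0), (if lam j = 0 then (T : ℂ) * β j
          else β j * ((cexp (I * lam j * T) - 1) / (I * lam j))).re =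
          ∑ j ∈ J.filter (fun j => lam j = 0), T * (β j).re := by
        refine Finset.sum_congr rfl fun j hj => ?_
        rw [Finset.mem_filter] at hj
        simp [hj.2]
      have h2 : ∑ j ∈ J.filter (fun j => ¬ lam j = 0), (if lam j = 0 then (T : ℂ) * β j
          else β j * ((cexp (I * lam j * T) - 1) / (I * lam j))).re ≤
          ∑ j ∈ J.filter (fun j => ¬ lam j = 0), 2 * ‖β j‖ / |lam j| := by
        refine Finset.sum_le_sum fun j hj => ?_
        rw [Finset.mem_filter] at hj
        rw [if_neg hj.2]
        refine (Complex.re_le_norm _).trans ?_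
        rw [norm_mul, norm_div, norm_mul, Complex.norm_I, one_mul, Complex.norm_real, Real.norm_eq_abs]
        have hexp : ‖cexp (I * lam j * T) - 1‖ ≤ 2 := by
          refine (norm_sub_le _ _).trans ?_
          rw [show I * (lam j : ℂ) * T = ((lam j * T : ℝ) : ℂ) * I by push_cast; ring,
            Complex.norm_exp_ofReal_mul_I, norm_one]
          norm_num
        have hlam : 0 < |lam j| := abs_pos.mpr hj.2
        calc ‖β j‖ * (‖cexp (I * lam j * T) - 1‖ / |lam j|) ≤ ‖β j‖ * (2 / |lam j|) := by gcongr
          _ = 2 * ‖β j‖ / |lam j| := by ring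
      have h3 : ∑ j ∈ J.filter (fun j => ¬ lam j = 0), 2 * ‖β j‖ / |lam j| ≤ C :=
        Finset.sum_le_sum_of_subset_of_nonneg (Finset.filter_subset _ _) fun j _ _ => by positivity
      rw [h1]
      linarith
    exact hnonneg.trans hsplit
  -- conclude
  by_contra hneg
  push Not at hneg
  have hT : 0 < (C + 1) / -Z := div_pos (by linarith) (by linarith)
  have hkey := key _ hT
  have hZ0 : Z ≠ 0 := hneg.ne
  have hprod : (C + 1) / -Z * Z = -(C + 1) := by
    field_simp
  linarith


/-! ## Unique factorisation: the zero frequencies -/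

/-- For sets of primes `A, B ⊆ S` and `n ≥ 1`: `log n_A − log n − log n_B = 0 ↔ (B ⊆ A ∧ n = n_{A∖B})`
(`n_X = Π_{p∈X} p`; injectivity of `log` and unique factorisation of squarefree numbers). [folklore] -/
theorem log_prod_sub_eq_zero_iff {S A B : Finset ℕ} (hS : ∀ p ∈ S, p.Prime) (hA : A ⊆ S) (hB : B ⊆ S)
    {n : ℕ} (hn : 1 ≤ n) :
    Real.log (∏ p ∈ A, (p : ℝ)) - Real.log n - Real.log (∏ p ∈ B, (p : ℝ)) = 0 ↔
      B ⊆ A ∧ n = ∏ p ∈ A \ B, p := by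
  classical
  have hpA : ∀ p ∈ A, p.Prime := fun p hp => hS p (hA hp)
  have hpB : ∀ p ∈ B, p.Prime := fun p hp => hS p (hB hp)
  have ha : 0 < ∏ p ∈ A, p := Finset.prod_pos fun p hp => (hpA p hp).pos
  have hb : 0 < ∏ p ∈ B, p := Finset.prod_pos fun p hp => (hpB p hp).pos
  rw [← Nat.cast_prod, ← Nat.cast_prod]
  -- `log a − log n − log b = 0 ↔ a = n b`
  have hlog : Real.log ((∏ p ∈ A, p : ℕ) : ℝ) - Real.log n - Real.log ((∏ p ∈ B, p : ℕ) : ℝ) = 0 ↔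
      (∏ p ∈ A, p) = n * ∏ p ∈ B, p := by
    rw [sub_sub, sub_eq_zero, ← Real.log_mul (by exact_mod_cast (show n ≠ 0 by omega))
      (by exact_mod_cast hb.ne'), ← Nat.cast_mul]
    constructor
    · intro h
      exact_mod_cast Real.log_injOn_pos (Set.mem_Ioi.mpr (by exact_mod_cast ha))
        (Set.mem_Ioi.mpr (by exact_mod_cast (Nat.mul_pos (by omega) hb))) h
    · intro h
      rw [h]
  rw [hlog]
  constructor
  · intro h
    have hBA : B ⊆ A := by
      intro p hp
      have hpp : p.Prime := hpB p hp
      have hdvd : p ∣ ∏ q ∈ A, q := by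
        rw [h]
        exact Dvd.dvd.mul_left (Finset.dvd_prod_of_mem _ hp) n
      obtain ⟨q, hq, hpq⟩ := (Nat.Prime.prime hpp).dvd_finsetProd_iff _ |>.mp hdvd
      rwa [(Nat.prime_dvd_prime_iff_eq hpp (hpA q hq)).mp hpq]
    refine ⟨hBA, ?_⟩
    have hsd : (∏ p ∈ A \ B, p) * ∏ p ∈ B, p = ∏ p ∈ A, p := Finset.prod_sdiff hBA
    rw [h] at hsd
    exact (Nat.eq_of_mul_eq_mul_right hb hsd).symm
  · rintro ⟨hBA, rfl⟩
    exact (Finset.prod_sdiff hBA).symm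

/-- `n_A = n_B ↔ A = B` for sets of primes. [folklore] -/
theorem prod_primes_inj {S A B : Finset ℕ} (hS : ∀ p ∈ S, p.Prime) (hA : A ⊆ S) (hB : B ⊆ S) :
    (∏ p ∈ A, p) = ∏ p ∈ B, p ↔ A = B := by
  refine ⟨fun h => ?_, fun h => by rw [h]⟩
  have hpA : ∀ p ∈ A, p.Prime := fun p hp => hS p (hA hp)
  have hpB : ∀ p ∈ B, p.Prime := fun p hp => hS p (hB hp)
  rw [← Nat.primeFactors_prod hpA, ← Nat.primeFactors_prod hpB, h]

/-! ## Re-indexing pairs `B ⊆ A ⊆ S` by `D = A ∖ B` -/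

/-- `Σ_{A⊆S} Σ_{B⊆A} g(A∖B) = Σ_{D⊆S} 2^{|S∖D|} g(D)` (for each `D`, the pairs are `A = D ∪ B`, `B ⊆ S∖D`).
[folklore] -/
theorem sum_powerset_pairs (S : Finset ℕ) (g : Finset ℕ → ℂ) :
    ∑ A ∈ S.powerset, ∑ B ∈ A.powerset, g (A \ B) = ∑ D ∈ S.powerset, (2 : ℂ) ^ (S \ D).card * g D := by
  classical
  induction S using Finset.induction_on generalizing g with
  | empty => simp
  | @insert q S hq ih =>
    rw [Finset.sum_powerset_insert hq, Finset.sum_powerset_insert hq]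
    have h1 : ∀ A ∈ S.powerset, ∑ B ∈ (insert q A).powerset, g (insert q A \ B) =
        ∑ B ∈ A.powerset, g (insert q (A \ B)) + ∑ B ∈ A.powerset, g (A \ B) := by
      intro A hA
      have hqA : q ∉ A := fun h => hq (Finset.mem_powerset.mp hA h)
      rw [Finset.sum_powerset_insert hqA]
      congr 1
      · refine Finset.sum_congr rfl fun B hB => ?_
        have hqB : q ∉ B := fun h => hqA (Finset.mem_powerset.mp hB h)
        rw [Finset.insert_sdiff_of_notMem _ hqB]
      · refine Finset.sum_congr rfl fun B hB => ?_
        rw [Finset.insert_sdiff_insert, Finset.sdiff_insert_of_notMem hqA]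
    have h2 : ∀ D ∈ S.powerset, (2 : ℂ) ^ (insert q S \ D).card * g D = 2 * ((2 : ℂ) ^ (S \ D).card * g D) := by
      intro D hD
      have hqD : q ∉ D := fun h => hq (Finset.mem_powerset.mp hD h)
      rw [Finset.insert_sdiff_of_notMem _ hqD, Finset.card_insert_of_notMem (fun h => hq (Finset.sdiff_subset h)),
        pow_succ]
      ring
    have h3 : ∀ D ∈ S.powerset, (2 : ℂ) ^ (insert q S \ insert q D).card * g (insert q D) =
        (2 : ℂ) ^ (S \ D).card * g (insert q D) := by
      intro D hD
      have hqD : q ∉ D := fun h => hq (Finset.mem_powerset.mp hD h)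
      rw [Finset.insert_sdiff_insert, Finset.sdiff_insert_of_notMem hq]
    rw [Finset.sum_congr rfl h1, Finset.sum_add_distrib, ih g, ih (fun D => g (insert q D)),
      Finset.sum_congr rfl h2, Finset.sum_congr rfl h3, ← Finset.mul_sum]
    ring

/-! ## The torus inequality from `Re P ≤ 1/2` on the line -/

/-- **The torus inequality for a Dirichlet polynomial with `Re P(1/2+it) ≤ 1/2`.**  Let `a : ℕ → ℝ` vanish on
`{n ≥ N}` and suppose `Σ_{1≤n<N} a(n) n^{-1/2} cos(t log n) ≤ 1/2` for every real `t`.  Then for every finite set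
`S` of primes and phase `φ`: `Σ_{D⊆S} a(n_D) n_D^{-1/2} 2^{-|D|} cos(|D|φ) ≤ 1/2`.  Proof: apply
`re_sum_filter_nonneg_of_trigSum_re_nonneg` to the expansion of
`(1/2 − Σ a(n) n^{-1/2} e^{-it log n}) · Q · Q̄`, `Q = Σ_{A⊆S} e^{i|A|φ} e^{it log n_A}` (nonnegative real part:
`(1/2 − Re P)|Q|²`); its zero frequencies are `(0, A, A)` and `(n_{A∖B}, A, B)` with `B ⊆ A`
(`log_prod_sub_eq_zero_iff`), summing to `2^{|S|}(1/2 − torus sum)` (`sum_powerset_pairs`). [folklore] -/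
theorem torusSum_le_half_of_re_le_half :
    ∀ (a : ℕ → ℝ) (N : ℕ), 1 ≤ N → (∀ n, N ≤ n → a n = 0) →
      (∀ t : ℝ, ∑ n ∈ Finset.Ico 1 N, a n / Real.sqrt n * Real.cos (Real.log n * t) ≤ 1 / 2) →
      ∀ S : Finset ℕ, (∀ p ∈ S, p.Prime) → ∀ φ : ℝ,
        ∑ D ∈ S.powerset, a (∏ p ∈ D, p) / Real.sqrt (∏ p ∈ D, (p : ℝ)) * (1 / 2) ^ D.card *
          Real.cos ((D.card : ℝ) * φ) ≤ 1 / 2 := by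
  intro a N hN ha h S hS φ
  classical
  -- coefficients and frequencies of the expansion, indexed by `(n, A, B)`
  set γ : ℕ → ℂ := fun n => if n = 0 then (1 / 2 : ℂ) else -((a n / Real.sqrt n : ℝ) : ℂ) with hγ
  set β : ℕ × (Finset ℕ × Finset ℕ) → ℂ := fun j =>
    γ j.1 * cexp (I * ((((j.2.1.card : ℝ) : ℂ) - ((j.2.2.card : ℝ) : ℂ)) * (φ : ℂ))) with hβ
  set lam : ℕ × (Finset ℕ × Finset ℕ) → ℝ := fun j =>
    Real.log (∏ p ∈ j.2.1, (p : ℝ)) - Real.log j.1 - Real.log (∏ p ∈ j.2.2, (p : ℝ)) with hlam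
  set J : Finset (ℕ × (Finset ℕ × Finset ℕ)) := Finset.range N ×ˢ (S.powerset ×ˢ S.powerset) with hJ
  -- (1) the expansion has nonnegative real part
  have hpos : ∀ t : ℝ, 0 ≤ (∑ j ∈ J, β j * cexp (I * (lam j * t))).re := by
    intro t
    set Pm : ℂ := ∑ n ∈ Finset.range N, γ n * cexp (-(I * (Real.log n * t))) with hPm
    set Q : ℂ := ∑ A ∈ S.powerset, cexp (I * (((A.card : ℝ) : ℂ) * (φ : ℂ))) *
      cexp (I * ((Real.log (∏ p ∈ A, (p : ℝ)) : ℂ) * (t : ℂ))) with hQ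
    have hexp : ∑ j ∈ J, β j * cexp (I * (lam j * t)) = Pm * Q * conj Q := by
      have hconjQ : conj Q = ∑ B ∈ S.powerset, cexp (-(I * (((B.card : ℝ) : ℂ) * (φ : ℂ)))) *
          cexp (-(I * ((Real.log (∏ p ∈ B, (p : ℝ)) : ℂ) * (t : ℂ)))) := by
        rw [hQ, map_sum]
        refine Finset.sum_congr rfl fun B _ => ?_
        rw [map_mul, ← Complex.exp_conj, ← Complex.exp_conj]
        congr 2 <;> simp [Complex.conj_ofReal]
      rw [hconjQ, hPm, hQ, Finset.sum_mul_sum, Finset.sum_mul_sum, hJ, Finset.sum_product]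
      refine Finset.sum_congr rfl fun n _ => ?_
      rw [Finset.sum_product, Finset.sum_comm]
      refine Finset.sum_congr rfl fun B _ => ?_
      rw [Finset.sum_mul]
      refine Finset.sum_congr rfl fun A _ => ?_
      simp only [hβ, hlam]
      have e1 : I * (((Real.log (∏ p ∈ A, (p : ℝ)) - Real.log n - Real.log (∏ p ∈ B, (p : ℝ)) : ℝ) : ℂ) *
          (t : ℂ)) = -(I * ((Real.log n : ℂ) * t)) + I * ((Real.log (∏ p ∈ A, (p : ℝ)) : ℂ) * t) +
            -(I * ((Real.log (∏ p ∈ B, (p : ℝ)) : ℂ) * t)) := by push_cast; ring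
      rw [e1, Complex.exp_add, Complex.exp_add]
      have e2 : I * ((((A.card : ℝ) : ℂ) - ((B.card : ℝ) : ℂ)) * (φ : ℂ)) =
          I * (((A.card : ℝ) : ℂ) * φ) + -(I * (((B.card : ℝ) : ℂ) * φ)) := by ring
      rw [e2, Complex.exp_add]
      ring
    have hPre : Pm.re = 1 / 2 - ∑ n ∈ Finset.Ico 1 N, a n / Real.sqrt n * Real.cos (Real.log n * t) := by
      rw [hPm, Finset.sum_range_eq_add_Ico _ hN, add_re, Complex.re_sum]
      have h0 : (γ 0 * cexp (-(I * (Real.log ((0 : ℕ) : ℝ) * t)))).re = 1 / 2 := by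
        simp [hγ]
      rw [h0]
      congr 1
      rw [← Finset.sum_neg_distrib]
      refine Finset.sum_congr rfl fun n hn => ?_
      have hn0 : n ≠ 0 := by rw [Finset.mem_Ico] at hn; omega
      simp only [hγ, hn0, if_false]
      rw [show -(I * ((Real.log n : ℝ) * t : ℂ)) = ((-(Real.log n * t) : ℝ) : ℂ) * I by push_cast; ring]
      rw [neg_mul, neg_re, Complex.re_ofReal_mul, Complex.exp_ofReal_mul_I_re, Real.cos_neg]
    have hreal : (Pm * Q * conj Q).re = Pm.re * Complex.normSq Q := by
      rw [mul_assoc, Complex.mul_conj, Complex.re_mul_ofReal]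
    rw [hexp, hreal, hPre]
    exact mul_nonneg (by linarith [h t]) (Complex.normSq_nonneg Q)
  -- (2) the zero-frequency coefficients
  have hzero := re_sum_filter_nonneg_of_trigSum_re_nonneg J β lam hpos
  -- evaluate `Σ_{λ = 0} β`
  have hinner : ∀ A ∈ S.powerset, ∀ B ∈ S.powerset,
      ∑ n ∈ Finset.range N, (if lam (n, (A, B)) = 0 then β (n, (A, B)) else 0) =
        (if A = B then (1 / 2 : ℂ) else 0) +
          (if B ⊆ A ∧ (∏ p ∈ A \ B, p) < N then β ((∏ p ∈ A \ B, p), (A, B)) else 0) := by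
    intro A hA B hB
    have hA' : A ⊆ S := Finset.mem_powerset.mp hA
    have hB' : B ⊆ S := Finset.mem_powerset.mp hB
    rw [Finset.sum_range_eq_add_Ico _ hN]
    congr 1
    · -- `n = 0`: frequency `log n_A − log n_B`
      have hl0 : lam (0, (A, B)) = 0 ↔ A = B := by
        simp only [hlam, Nat.cast_zero, Real.log_zero, sub_zero]
        rw [sub_eq_zero, ← Nat.cast_prod, ← Nat.cast_prod]
        have ha : 0 < ∏ p ∈ A, p := Finset.prod_pos fun p hp => (hS p (hA' hp)).pos
        have hb : 0 < ∏ p ∈ B, p := Finset.prod_pos fun p hp => (hS p (hB' hp)).pos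
        rw [← prod_primes_inj hS hA' hB']
        constructor
        · intro h
          exact_mod_cast Real.log_injOn_pos (Set.mem_Ioi.mpr (by exact_mod_cast ha))
            (Set.mem_Ioi.mpr (by exact_mod_cast hb)) h
        · intro h
          rw [h]
      by_cases hAB : A = B
      · rw [if_pos (hl0.mpr hAB), if_pos hAB]
        subst hAB
        simp [hβ, hγ]
      · rw [if_neg (fun h => hAB (hl0.mp h)), if_neg hAB]
    · -- `1 ≤ n < N`: frequency zero iff `B ⊆ A`, `n = n_{A∖B}`
      by_cases hc : B ⊆ A ∧ (∏ p ∈ A \ B, p) < N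
      · rw [if_pos hc]
        have hmem : (∏ p ∈ A \ B, p) ∈ Finset.Ico 1 N := by
          rw [Finset.mem_Ico]
          exact ⟨Finset.prod_pos fun p hp => (hS p (hA' (Finset.sdiff_subset hp))).pos, hc.2⟩
        rw [Finset.sum_eq_single_of_mem _ hmem]
        · rw [if_pos]
          exact (log_prod_sub_eq_zero_iff hS hA' hB' (Finset.mem_Ico.mp hmem).1).mpr ⟨hc.1, rfl⟩
        · intro n hn hne
          rw [if_neg]
          intro h0
          exact hne ((log_prod_sub_eq_zero_iff hS hA' hB' (Finset.mem_Ico.mp hn).1).mp h0).2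
      · rw [if_neg hc]
        refine Finset.sum_eq_zero fun n hn => ?_
        rw [if_neg]
        intro h0
        obtain ⟨hBA, rfl⟩ := (log_prod_sub_eq_zero_iff hS hA' hB' (Finset.mem_Ico.mp hn).1).mp h0
        exact hc ⟨hBA, (Finset.mem_Ico.mp hn).2⟩
  have hsum : ∑ j ∈ J.filter (fun j => lam j = 0), β j =
      (2 : ℂ) ^ S.card / 2 + ∑ D ∈ S.powerset, (2 : ℂ) ^ (S \ D).card *
        (if (∏ p ∈ D, p) < N then γ (∏ p ∈ D, p) * cexp (I * (((D.card : ℝ) : ℂ) * (φ : ℂ))) else 0) := by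
    rw [Finset.sum_filter, hJ, Finset.sum_product, Finset.sum_comm, Finset.sum_product]
    rw [Finset.sum_congr rfl fun A hA => Finset.sum_congr rfl fun B hB => hinner A hA B hB]
    simp only [Finset.sum_add_distrib]
    congr 1
    · rw [Finset.sum_congr rfl fun A hA => Finset.sum_ite_eq S.powerset A (fun _ => (1 / 2 : ℂ))]
      simp only [Finset.sum_ite_mem, Finset.inter_self, Finset.sum_const, Finset.card_powerset, nsmul_eq_mul]
      push_cast
      ring
    · rw [← sum_powerset_pairs]
      refine Finset.sum_congr rfl fun A hA => ?_
      have hA' : A ⊆ S := Finset.mem_powerset.mp hA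
      -- restrict `B` to the subsets of `A`
      rw [← Finset.sum_filter_add_sum_filter_not S.powerset (fun B => B ⊆ A)]
      have hfil : S.powerset.filter (fun B => B ⊆ A) = A.powerset := by
        ext B
        simp only [Finset.mem_filter, Finset.mem_powerset]
        exact ⟨fun h => h.2, fun h => ⟨h.trans hA', h⟩⟩
      rw [hfil, Finset.sum_eq_zero (s := S.powerset.filter fun B => ¬ B ⊆ A) fun B hB => by
        rw [Finset.mem_filter] at hB
        rw [if_neg (fun h => hB.2 h.1)], add_zero]
      refine Finset.sum_congr rfl fun B hB => ?_
      have hBA : B ⊆ A := Finset.mem_powerset.mp hB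
      simp only [hBA, true_and, hβ]
      have hcard : ((A.card : ℝ) : ℂ) - ((B.card : ℝ) : ℂ) = (((A \ B).card : ℝ) : ℂ) := by
        rw [Finset.card_sdiff_of_subset hBA, Nat.cast_sub (Finset.card_le_card hBA)]
        push_cast
        ring
      rw [hcard]
  -- (3) real parts: `0 ≤ Re Σ_{λ=0} β = 2^{|S|} (1/2 − torus sum)`
  rw [hsum] at hzero
  have hre : ((2 : ℂ) ^ S.card / 2 + ∑ D ∈ S.powerset, (2 : ℂ) ^ (S \ D).card *
      (if (∏ p ∈ D, p) < N then γ (∏ p ∈ D, p) * cexp (I * (((D.card : ℝ) : ℂ) * (φ : ℂ))) else 0)).re =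
      (2 : ℝ) ^ S.card * (1 / 2 - ∑ D ∈ S.powerset, a (∏ p ∈ D, p) / Real.sqrt (∏ p ∈ D, (p : ℝ)) *
        (1 / 2) ^ D.card * Real.cos ((D.card : ℝ) * φ)) := by
    rw [add_re, Complex.re_sum, mul_sub, Finset.mul_sum]
    have h2 : ((2 : ℂ) ^ S.card / 2).re = (2 : ℝ) ^ S.card * (1 / 2) := by
      rw [show (2 : ℂ) ^ S.card / 2 = (((2 : ℝ) ^ S.card * (1 / 2) : ℝ) : ℂ) by push_cast; ring,
        Complex.ofReal_re]
    rw [h2, sub_eq_add_neg, ← Finset.sum_neg_distrib]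
    congr 1
    refine Finset.sum_congr rfl fun D hD => ?_
    have hD' : D ⊆ S := Finset.mem_powerset.mp hD
    have hD0 : (∏ p ∈ D, p) ≠ 0 := (Finset.prod_pos fun p hp => (hS p (hD' hp)).pos).ne'
    have hpow : (2 : ℝ) ^ (S \ D).card = (2 : ℝ) ^ S.card * (1 / 2) ^ D.card := by
      rw [Finset.card_sdiff_of_subset hD', one_div, inv_pow, ← div_eq_mul_inv,
        eq_div_iff (pow_ne_zero _ two_ne_zero), ← pow_add, Nat.sub_add_cancel (Finset.card_le_card hD')]
    by_cases hlt : (∏ p ∈ D, p) < N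
    · rw [if_pos hlt]
      simp only [hγ, hD0, if_false]
      have e1 : I * (((D.card : ℝ) : ℂ) * (φ : ℂ)) = (((D.card : ℝ) * φ : ℝ) : ℂ) * I := by
        push_cast; ring
      rw [e1]
      have e2 : (2 : ℂ) ^ (S \ D).card * (-(((a (∏ p ∈ D, p) / Real.sqrt ↑(∏ p ∈ D, p)) : ℝ) : ℂ) *
          cexp ((((D.card : ℝ) * φ : ℝ) : ℂ) * I)) =
          ((-((2 : ℝ) ^ (S \ D).card * (a (∏ p ∈ D, p) / Real.sqrt ↑(∏ p ∈ D, p))) : ℝ) : ℂ) *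
            cexp ((((D.card : ℝ) * φ : ℝ) : ℂ) * I) := by push_cast; ring
      rw [e2, Complex.re_ofReal_mul, Complex.exp_ofReal_mul_I_re, hpow, Nat.cast_prod]
      ring
    · rw [if_neg hlt, mul_zero, Complex.zero_re, ha _ (not_lt.mp hlt)]
      simp
  rw [hre] at hzero
  have h2pos : (0 : ℝ) < (2 : ℝ) ^ S.card := pow_pos two_pos _
  nlinarith

end Summit.RiemannHypothesis.RiemannHypothesis.Theorems.SignConeConeMagnification

end
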